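import Summits.Schanuel.Schanuel.Theorems.ZilberEacDensityConverse
import Summits.Schanuel.Schanuel.Theorems.ZilberEacGraphLiftRotund
import HarnessLib

/-!
# The EAC ladder is monotone: `ECCell (n+1) d → ECCell n d`, and `EC(3,2)` is the weakest open cell

Zilber's Exponential-Algebraic Closedness, case ladder (host summit Schanuel, cell `pub-schanuel`,
seat 2, gen 6).  `ZilberEacDensityConverse` proved the diagonal monotonicity
`ECCell (n+1) (d+1) → ECCell n d` by the density lift.  Here the GRAPH LIFT
`W^f(W) = {w ∈ W, x_{n+1} = f(x_w)}` (`ZilberEacGraphLift*`, `y_{n+1}` free) gives the COLUMN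
monotonicity `ECCell (n+1) d → ECCell n d` (`ecCell_of_ecCell_succ_left`): the lift of a member of the
cell `(n, d)` is a member of the cell `(n+1, d)` — irreducible of dimension `n+1`, meets the torus,
rotund (`isRotund_graphVar_of_isRotund`), multiplicatively free, with the SAME `addProjDim` (its base
is the graph of `f`), and additively free as soon as no nonzero integer multiple of `f` is congruent on
the base to an affine `ℤ`-linear form; such an `f` exists among the powers `x_j^k`, `2 ≤ k ≤ n + 3`, of
any coordinate (`exists_pow_additive_witness`: `n + 2` powers cannot all be affine-linear on the base,
whose coordinate functions span at most `n + 1` dimensions, unless `x_j` takes finitely many values on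
`W ∩ Gⁿ`, which additive freeness forbids); and an exponential point of the lift lies over an
exponential point of `W`.

Consequence (`ecCell_three_two_of_ecCell`): EVERY cell of the open regime (`n ≥ 3`, `2 ≤ d ≤ n - 1`)
implies the first open rung `ECCell 3 2` — Mantova–Masser's "simplest case" is the logically weakest
open cell of Zilber's conjecture.

HONEST FRAMING: implications between OPEN statements; no case of EAC is proved; `EC(3,2)` OPEN;
nothing here bears on Schanuel's conjecture (EAC does not imply SC).
-/

noncomputable section

open MvPolynomial
open Literature.NumberTheory.Transcendental Literature.ModelTheory.Zilber
open Literature.ModelTheory.ExponentialFields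

set_option linter.dupNamespace false

namespace Summit.Schanuel.Schanuel.Theorems

variable {n d : ℕ}

/-! ## A power of a coordinate is not affine-linear on an additively free variety -/

/-- **Additive witnesses exist**: if `S ∩ Gⁿ` is additively free (`S` irreducible, meeting `Gⁿ`) then
for every coordinate `j` some power `x_j^{k+2}`, `k ≤ n + 1`, is congruent on `S ∩ Gⁿ` to no affine
`ℤ`-linear form divided by a nonzero integer (`n + 2` powers in the `≤ n + 1`-dimensional span of the
affine coordinate functions would make `x_j` take finitely many values). [folklore] -/
theorem exists_pow_additive_witness {S : Set (Fin n ⊕ Fin n → ℂ)} (hS : IsIrreducibleClosed ℂ S)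
    (hne : (S ∩ torusLocus ℂ n).Nonempty) (hadd : IsAddFree ℂ n (S ∩ torusLocus ℂ n)) (j : Fin n) :
    ∃ k : ℕ, ∀ (m : Fin n → ℤ) (q : ℤ), q ≠ 0 → ∀ c : ℂ, ¬ ∀ z ∈ S ∩ torusLocus ℂ n,
      (∑ i, (m i : ℂ) * z (Sum.inl i)) + (q : ℂ) *
        MvPolynomial.eval (projAdd z) ((X j : MvPolynomial (Fin n) ℂ) ^ (k + 2)) = c := by
  classical
  by_contra hcon
  push Not at hcon
  -- the affine coordinate functions on `S ∩ Gⁿ`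
  set V0 := S ∩ torusLocus ℂ n with hV0
  let coordFn : Option (Fin n) → (V0 → ℂ) := fun o z => o.elim 1 fun i => (z : Fin n ⊕ Fin n → ℂ) (Sum.inl i)
  set V : Submodule ℂ (V0 → ℂ) := Submodule.span ℂ (Set.range coordFn) with hV
  haveI : Module.Finite ℂ V := FiniteDimensional.span_of_finite ℂ (Set.finite_range _)
  have hVdim : Module.finrank ℂ V ≤ n + 1 := by
    have := finrank_span_le_card (R := ℂ) (Set.range coordFn)
    refine this.trans ?_
    rw [Set.toFinset_range]
    exact (Finset.card_image_le).trans (by simp)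
  -- the powers `z ↦ z_j^{k+2}`, `k < n + 2`, lie in `V`
  have hpow : ∀ k : Fin (n + 2), (fun z : V0 => (z : Fin n ⊕ Fin n → ℂ) (Sum.inl j) ^ ((k : ℕ) + 2)) ∈ V := by
    intro k
    obtain ⟨m, q, hq, c, hc⟩ := hcon k
    -- `z_j^{k+2} = q⁻¹ (c - ∑ mᵢ zᵢ)`
    have hq' : (q : ℂ) ≠ 0 := by exact_mod_cast hq
    have hfun : (fun z : V0 => (z : Fin n ⊕ Fin n → ℂ) (Sum.inl j) ^ ((k : ℕ) + 2)) =
        (q : ℂ)⁻¹ • (c • coordFn none - ∑ i, (m i : ℂ) • coordFn (some i)) := by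
      funext z
      have hz := hc z z.2
      simp only [map_pow, eval_X, projAdd_apply] at hz
      have key : (z : Fin n ⊕ Fin n → ℂ) (Sum.inl j) ^ ((k : ℕ) + 2) =
          (q : ℂ)⁻¹ * (c - ∑ i, (m i : ℂ) * (z : Fin n ⊕ Fin n → ℂ) (Sum.inl i)) := by
        rw [← hz, add_sub_cancel_left, ← mul_assoc, inv_mul_cancel₀ hq', one_mul]
      rw [key]
      simp only [coordFn, Pi.smul_apply, Pi.sub_apply, Finset.sum_apply, smul_eq_mul, Option.elim,
        mul_one]
    rw [hfun]
    refine V.smul_mem _ (V.sub_mem (V.smul_mem _ (Submodule.subset_span ⟨none, rfl⟩))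
      (V.sum_mem fun i _ => V.smul_mem _ (Submodule.subset_span ⟨some i, rfl⟩)))
  -- `n + 2` vectors in a space of dimension `≤ n + 1` are dependent
  let g : Fin (n + 2) → V := fun k => ⟨_, hpow k⟩
  have hdep : ¬ LinearIndependent ℂ g := by
    intro hind
    have := hind.fintype_card_le_finrank
    rw [Fintype.card_fin] at this
    omega
  obtain ⟨a, ha, k₀, hk₀⟩ := Fintype.not_linearIndependent_iff.1 hdep
  -- the polynomial `P = ∑ aₖ X^{k+2}` kills `z_j` for every `z ∈ S ∩ Gⁿ`
  set P : Polynomial ℂ := ∑ k : Fin (n + 2), Polynomial.C (a k) * Polynomial.X ^ ((k : ℕ) + 2) with hP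
  have hP0 : P ≠ 0 := by
    intro h0
    apply hk₀
    have := congrArg (fun p => p.coeff ((k₀ : ℕ) + 2)) h0
    rw [hP, Polynomial.finsetSum_coeff, Polynomial.coeff_zero] at this
    simp only [Polynomial.coeff_C_mul_X_pow] at this
    rw [Finset.sum_eq_single k₀] at this
    · simpa using this
    · intro k _ hk
      rw [if_neg]
      intro h
      exact hk (Fin.ext (by omega))
    · intro h
      exact absurd (Finset.mem_univ _) h
  have hroot : ∀ z ∈ S ∩ torusLocus ℂ n, P.IsRoot (z (Sum.inl j)) := by
    intro z hz
    have := congrArg (fun v : V => (v : V0 → ℂ) ⟨z, hz⟩) ha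
    simp only [Submodule.coe_sum, Submodule.coe_smul, Finset.sum_apply, Pi.smul_apply, smul_eq_mul,
      g, Submodule.coe_zero, Pi.zero_apply] at this
    rw [Polynomial.IsRoot.def, hP, Polynomial.eval_finsetSum]
    simp only [Polynomial.eval_mul, Polynomial.eval_C, Polynomial.eval_pow, Polynomial.eval_X]
    exact this
  -- hence `∏_{r root} (x_j - r)` vanishes on `S ∩ Gⁿ`, so some `x_j - r ∈ I(S)`: `x_j` constant
  haveI := hS.2
  set Q : MvPolynomial (Fin n ⊕ Fin n) ℂ := ∏ r ∈ P.roots.toFinset, (X (Sum.inl j) - C r) with hQ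
  have hQmem : Q ∈ vanishingIdeal ℂ S := by
    rw [← vanishingIdeal_inter_torusLocus hS hne, mem_vanishingIdeal_iff]
    intro z hz
    rw [hQ, map_prod]
    refine Finset.prod_eq_zero (i := z (Sum.inl j)) ?_ ?_
    · rw [Multiset.mem_toFinset, Polynomial.mem_roots hP0]
      exact hroot z hz
    · rw [map_sub, aeval_X, aeval_C, Algebra.algebraMap_self, RingHom.id_apply, sub_self]
  obtain ⟨r, -, hr⟩ := (Ideal.IsPrime.prod_mem_iff (p := vanishingIdeal ℂ S)).1 hQmem
  refine hadd (Pi.single j 1) (by simp) ⟨r, fun z hz => ?_⟩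
  have := (mem_vanishingIdeal_iff.1 hr) z hz.1
  rw [map_sub, aeval_X, aeval_C, Algebra.algebraMap_self, RingHom.id_apply, sub_eq_zero] at this
  rw [← this]
  simp [Pi.single_apply, Finset.sum_ite_eq', Int.cast_ite]

/-! ## The graph lift raises `n` and keeps `d` -/

/-- **The graph lift is a member of the cell `(n+1, d)`** when `W` is a member of the cell `(n, d)`
and `f` is an additive witness. [folklore] -/
theorem ecCell_binders_graphVar {W : Set (Fin n ⊕ Fin n → ℂ)} (hW : IsIrreducibleClosed ℂ W)
    (hne : (W ∩ torusLocus ℂ n).Nonempty) (hrot : IsRotund ℂ n (W ∩ torusLocus ℂ n))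
    (hadd : IsAddFree ℂ n (W ∩ torusLocus ℂ n)) (hmul : IsMulFree ℂ n (W ∩ torusLocus ℂ n))
    (hdim : zariskiDim ℂ W = n) (hapd : addProjDim ℂ n W = d) (f : MvPolynomial (Fin n) ℂ)
    (hf : ∀ (m : Fin n → ℤ) (q : ℤ), q ≠ 0 → ∀ c : ℂ, ¬ ∀ z ∈ W ∩ torusLocus ℂ n,
      (∑ i, (m i : ℂ) * z (Sum.inl i)) + (q : ℂ) * MvPolynomial.eval (projAdd z) f = c) :
    IsIrreducibleClosed ℂ (graphVar f W) ∧
      (graphVar f W ∩ torusLocus ℂ (n + 1)).Nonempty ∧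
      IsRotund ℂ (n + 1) (graphVar f W ∩ torusLocus ℂ (n + 1)) ∧
      IsAddFree ℂ (n + 1) (graphVar f W ∩ torusLocus ℂ (n + 1)) ∧
      IsMulFree ℂ (n + 1) (graphVar f W ∩ torusLocus ℂ (n + 1)) ∧
      zariskiDim ℂ (graphVar f W) = (n + 1 : ℕ) ∧
      addProjDim ℂ (n + 1) (graphVar f W) = d := by
  refine ⟨isIrreducibleClosed_graphVar f hW, graphVar_inter_torusLocus_nonempty f hne,
    isRotund_graphVar_of_isRotund f hW hne hrot, isAddFree_graphVar f hadd hf,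
    isMulFree_graphVar f hne hmul, ?_, ?_⟩
  · rw [zariskiDim_graphVar, hdim]
    norm_cast
  · rw [addProjDim_graphVar, hapd]

/-- An exponential point of the graph lift lies over an exponential point of `W`. [folklore] -/
theorem exists_mem_inter_expGraph_of_mem_graphVar {W : Set (Fin n ⊕ Fin n → ℂ)}
    {f : MvPolynomial (Fin n) ℂ} {w : Fin (n + 1) ⊕ Fin (n + 1) → ℂ}
    (hw : w ∈ graphVar f W ∩ expGraph ℂ (n + 1)) : (W ∩ expGraph ℂ n).Nonempty := by
  obtain ⟨hwW, hwΓ⟩ := hw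
  obtain ⟨s, hs, t, rfl⟩ := (mem_graphVar_iff f).1 hwW
  rw [mem_expGraph_iff] at hwΓ
  refine ⟨s, hs, ?_⟩
  rw [mem_expGraph_iff]
  intro i
  have := hwΓ (Fin.castSucc i)
  rwa [graphPt_inr_castSucc, graphPt_inl_castSucc] at this

/-! ## Column monotonicity and the weakest open cell -/

/-- **Column monotonicity of the EAC ladder**: `ECCell (n+1) d → ECCell n d`. [folklore] -/
theorem ecCell_of_ecCell_succ_left (h : ECCell (n + 1) d) : ECCell n d := by
  cases n with
  | zero => exact ecCell_zero_left d
  | succ n =>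
    intro W hW hne hrot hadd hmul hdim hapd
    obtain ⟨k, hk⟩ := exists_pow_additive_witness hW hne hadd 0
    obtain ⟨h1, h2, h3, h4, h5, h6, h7⟩ :=
      ecCell_binders_graphVar hW hne hrot hadd hmul hdim hapd _ hk
    obtain ⟨w, hw⟩ := h _ h1 h2 h3 h4 h5 h6 h7
    exact exists_mem_inter_expGraph_of_mem_graphVar hw

/-- Column monotonicity, iterated: `ECCell (n+j) d → ECCell n d`. [folklore] -/
theorem ecCell_of_ecCell_add_left (j : ℕ) (h : ECCell (n + j) d) : ECCell n d := by
  induction j with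
  | zero => simpa using h
  | succ j ih => exact ih (ecCell_of_ecCell_succ_left (n := n + j) h)

/-- **Monotonicity of the EAC ladder**: `ECCell n d → ECCell n' d'` whenever `d' ≤ d` and the base
codimension does not increase, `n' - d' ≤ n - d` (written `n' + d ≤ n + d'`): compose `d - d'` diagonal
steps (`ecCell_of_ecCell_add`, density lift) with `(n - d) - (n' - d')` column steps
(`ecCell_of_ecCell_add_left`, graph lift). [folklore] -/
theorem ecCell_mono {n' d' : ℕ} (hd : d' ≤ d) (hc : n' + d ≤ n + d') (h : ECCell n d) : ECCell n' d' := by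
  obtain ⟨a, rfl⟩ := Nat.exists_eq_add_of_le hd
  obtain ⟨b, rfl⟩ : ∃ b, n = n' + b + a := ⟨n - n' - a, by omega⟩
  exact ecCell_of_ecCell_add_left b (ecCell_of_ecCell_add a h)

/-- **`EC(3,2)` is the weakest open cell**: every cell of the open regime `n ≥ 3`, `2 ≤ d ≤ n - 1`
implies the first open rung `ECCell 3 2`. [cite: MantovaMasser2023, §1 Further remarks, p. 5] -/
theorem ecCell_three_two_of_ecCell (hd : 2 ≤ d) (hdn : d + 1 ≤ n) (h : ECCell n d) : ECCell 3 2 :=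
  ecCell_mono hd (by omega) h

/-- All cells up to level `N` follow from the cells AT level `N` (column monotonicity). [folklore] -/
theorem ecCell_of_ecCell_level {N : ℕ} (hn : n ≤ N) (h : ∀ d, ECCell N d) : ECCell n d := by
  obtain ⟨b, rfl⟩ := Nat.exists_eq_add_of_le hn
  exact ecCell_of_ecCell_add_left b (h d)

/-- **EAC is decided at any cofinal set of levels**: `ℂ_exp` is exponentially-algebraically closed iff
for arbitrarily large `N` every cell `ECCell N d` at level `N` holds. [folklore] -/
theorem isExpAlgClosed_complex_iff_cofinal :
    IsExpAlgClosed ℂ ↔ ∀ N₀ : ℕ, ∃ N, N₀ ≤ N ∧ ∀ d, ECCell N d := by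
  rw [isExpAlgClosed_complex_iff_forall_ecCell]
  refine ⟨fun h N₀ => ⟨N₀, le_rfl, fun d => h N₀ d⟩, fun h n d => ?_⟩
  obtain ⟨N, hN, hcells⟩ := h n
  exact ecCell_of_ecCell_level hN hcells

/-- In particular `IsExpAlgClosed ℂ → ECCell 3 2` (the first open rung is a consequence of EAC, and by
`ecCell_three_two_of_ecCell` of each single open cell). [folklore] -/
theorem ecCell_three_two_of_isExpAlgClosed (h : IsExpAlgClosed ℂ) : ECCell 3 2 :=
  isExpAlgClosed_complex_iff_forall_ecCell.1 h 3 2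

end Summit.Schanuel.Schanuel.Theorems
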